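import Mathlib
import HarnessLib
import Summits.Ventures.LatticeQCDFlow.Exactness.LatticeSiteResampling
import Summits.Ventures.LatticeQCDFlow.Exactness.LatticeCoordAvg
import Summits.Ventures.LatticeQCDFlow.Scaling.U1ConvolutionPowerPeak
import Summits.Ventures.LatticeQCDFlow.TrivializingMaps.SpecificHeatCeilingTwoDim

/-!
# LatticeQCDFlow / Scaling — two dimensions, `U(1)`: the law of ONE plaquette holonomy of the Wilson
# measure has the continuous, strictly peaked density `w·(K_w^{L²−2} w)`; it is not a.e. constant

HONEST FRAMING: exact (Metropolis-corrected) sampling algorithms for lattice gauge theory;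
figures of merit are autocorrelation/cost numbers at stated couplings and volumes; no
continuum-physics claim.

Venture `LatticeQCDFlow` (cell pub-lqcd), topic `Scaling`, FANOUT row 30 (lean-1, GEN-17) — OUR WORK,
the measure-level half of the 2-d `U(1)` gauge lower bound for THEORY-2 §4 C5 (sequel:
`Scaling/AutoregressiveGaugePlaquetteReads` — the link closing a plaquette READS its staple).  For the
torus `(ℤ/L)²`, `L ≥ 2`, `G = U(1)`, the Wilson weight `F = e^{−β S_W}` (`u1Rep`), `β ≥ 0`, and a
plaquette `x`:

* §1 `measurable_coordAvg` (bounded measurable weights have measurable coordinate averages);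
  **`integral_comp_plaquetteHolonomy`** — under product Haar the holonomy of a plaquette is
  Haar-distributed, `∫ H(hol_x U) dHaar^{⊗E} = ∫ H dHaar` (redraw the first link; right invariance);
  any compact group, any `d`.
* §2 `wilsonWeight_two_u1_eq_prod` — `e^{−β S_W(U)} = ∏_y w_β(hol_y U)` (`u1W`, real and `ℝ≥0∞`
  forms), measurable, `e^{−2βL²} ≤ F ≤ 1`.
* §3 **`wilson2D_u1_setIntegral_holonomy_eq`** — THE ONE-PLAQUETTE LAW: for every measurable
  `A ⊆ U(1)`, `∫ 1_A(hol_x U) F(U) dHaar^{⊗E}(U) = ∫_A D dHaar`, `D(g) = (w_β(g)·(K_w^{L²−2} w_β)(g)).toReal`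
  (`Scaling/PlaquetteMarginals2D.lintegral_weight_mul_eq_iterate` with `P = {x}` and the puncture at
  `x + e₀ ≠ x`, transported to Bochner integrals).
* §4 **`continuous_u1_iterate_toReal`** — the convolution powers `K_wᵐ w_β` are continuous
  (dominated convergence; `w_β` is continuous); hence `D` is continuous, and with the strict peak of
  `Scaling/U1ConvolutionPowerPeak.u1_plaquetteDensity_lt` (`β > 0`) and the positivity of Haar measure
  on open sets, **`wilson2D_u1_density_not_ae_const`**: `D` is not Haar-a.e. equal to any constant.

NOT CLAIMED: non-abelian groups, `d ≥ 3`; any number of ours.  Elementary over the parents; no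
`def`; nothing is cited as a fact; no `sorry`.
-/

noncomputable section

namespace Summit.Ventures.LatticeQCDFlow.Theory2.Autoregressive

open MeasureTheory Function Set
open Literature.MathematicalPhysics.QuantumFieldTheory Literature.MathematicalPhysics.QuantumLattice
open Summit.Ventures.LatticeQCDFlow.Exactness Summit.Ventures.LatticeQCDFlow.Theory2.HaarConv
open Summit.Ventures.LatticeQCDFlow.Theory2.Lattice.TwoDim (measurable_circle_re abs_circle_re_le_one
  lintegral_weight_mul_eq_iterate)
open scoped ENNReal

/-! ## §1 Measurability of coordinate averages; the plaquette holonomy is Haar-distributed -/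

section General

variable {ι : Type*} [Fintype ι] [DecidableEq ι] {X : Type*} [MeasurableSpace X]
variable (μ : Measure X) [IsProbabilityMeasure μ]

/-- A measurable weight has a measurable coordinate average (Fubini measurability). [ours] -/
theorem measurable_coordAvg (s : Finset ι) {G : (ι → X) → ℝ} (hG : Measurable G) :
    Measurable (coordAvg μ s G) := by
  have hm : Measurable fun p : (ι → X) × (ι → X) => G (s.piecewise p.2 p.1) :=
    hG.comp (measurable_piecewise_prod s)
  exact (hm.stronglyMeasurable.integral_prod_right' (ν := Measure.pi fun _ : ι => μ)).measurable

end General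

variable {L : ℕ} [NeZero L]

omit [NeZero L] in
/-- On `(ℤ/L)^d` with `L ≥ 2` a unit shift moves every site. [folklore] -/
theorem site_shift_ne {d : ℕ} (hL : 2 ≤ L) (x : Site d L) (i : Fin d) : x.shift i ≠ x := by
  intro h
  have h1 := congrFun h i
  simp only [Site.shift, Pi.add_apply, Pi.single_eq_same, add_eq_left] at h1
  haveI : Fact (1 < L) := ⟨hL⟩
  exact one_ne_zero h1

omit [NeZero L] in
/-- Updating the first link of a plaquette multiplies its holonomy on the left (the three other links
are different links: `i ≠ j`, `L ≥ 2`). [ours] -/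
theorem plaquetteHolonomy_update_first {d : ℕ} {G : Type*} [Group G] (hL : 2 ≤ L)
    (U : GaugeConfig d L G) (x : Site d L) {i j : Fin d} (hij : i ≠ j) (v : G) :
    plaquetteHolonomy (update U (x, i) v) x i j =
      v * (U (x.shift i, j) * (U (x.shift j, i))⁻¹ * (U (x, j))⁻¹) := by
  have n12 : ((x.shift i, j) : Edge d L) ≠ (x, i) := fun h => hij (congrArg Prod.snd h).symm
  have n13 : ((x.shift j, i) : Edge d L) ≠ (x, i) := fun h => site_shift_ne hL x j (congrArg Prod.fst h)
  have n14 : ((x, j) : Edge d L) ≠ (x, i) := fun h => hij (congrArg Prod.snd h).symm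
  simp only [plaquetteHolonomy, update_self, update_of_ne n12, update_of_ne n13, update_of_ne n14,
    mul_assoc]

/-- **Under product Haar the holonomy of a plaquette is Haar-distributed**: for bounded measurable
`H : G → ℝ`, `∫ H(hol_x U) dHaar^{⊗E}(U) = ∫ H dHaar` (redraw the link `(x, i)`: the holonomy is
`U_{(x,i)}` times a word in the other links; right invariance of Haar). [ours] -/
theorem integral_comp_plaquetteHolonomy {d : ℕ} {G : Type*} [Group G] [TopologicalSpace G]
    [IsTopologicalGroup G] [CompactSpace G] [SecondCountableTopology G] [MeasurableSpace G]
    [BorelSpace G] (hL : 2 ≤ L)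
    (x : Site d L) {i j : Fin d} (hij : i ≠ j) {H : G → ℝ} (hHm : Measurable H) {C : ℝ}
    (hHb : ∀ g, |H g| ≤ C) :
    ∫ U, H (plaquetteHolonomy U x i j) ∂Measure.pi (fun _ : Edge d L => haarProbability G) =
      ∫ g, H g ∂(haarProbability G) := by
  have huniv : (fun _ : Edge d L => haarProbability G) (x, i) Set.univ ≠ 0 := by simp
  have hmeas : Measurable fun U : GaugeConfig d L G => H (plaquetteHolonomy U x i j) :=
    hHm.comp (measurable_plaquetteHolonomy x i j)
  have hint : Integrable (fun U : GaugeConfig d L G => H (plaquetteHolonomy U x i j))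
      (Measure.pi fun _ : Edge d L => haarProbability G) :=
    Integrable.mono' (integrable_const C) hmeas.aestronglyMeasurable
      (ae_of_all _ fun U => by rw [Real.norm_eq_abs]; exact hHb _)
  rw [integral_pi_eq_integral_integral_update' (fun _ : Edge d L => haarProbability G) (x, i) huniv hint]
  simp only [measure_univ, inv_one, ENNReal.toReal_one, one_smul]
  have hinner : ∀ U : GaugeConfig d L G,
      ∫ v, H (plaquetteHolonomy (update U (x, i) v) x i j) ∂(haarProbability G) =
        ∫ g, H g ∂(haarProbability G) := by
    intro U
    simp only [plaquetteHolonomy_update_first hL U x hij]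
    exact integral_mul_right_eq_self H _
  simp_rw [hinner]
  rw [integral_const, Measure.real, measure_univ, ENNReal.toReal_one, one_smul]

/-! ## §2 The 2-d `U(1)` Wilson weight as a product of one-plaquette weights -/

section TwoDimU1

variable (β : ℝ)

/-- `e^{−β S_W(U)} = ∏_y w_β(hol_y U)` (real form of `u1W`). [ours] -/
theorem wilsonWeight_two_u1_eq_prod (U : GaugeConfig 2 L Circle) :
    Real.exp (-β * wilsonAction u1Rep U) =
      ∏ y : Site 2 L, (u1W β (plaquetteHolonomy U y 0 1)).toReal := by
  rw [TrivializingMaps.wilsonAction_two_eq_sum_sites u1Rep U, Finset.mul_sum, Real.exp_sum]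
  refine Finset.prod_congr rfl fun y _ => ?_
  rw [u1W_apply, ENNReal.toReal_ofReal (Real.exp_pos _).le, trace_u1Rep_re]
  congr 1
  push_cast
  ring

/-- The same in `ℝ≥0∞`: `ofReal e^{−β S_W(U)} = ∏_y w_β(hol_y U)`. [ours] -/
theorem ofReal_wilsonWeight_two_u1_eq_prod (U : GaugeConfig 2 L Circle) :
    ENNReal.ofReal (Real.exp (-β * wilsonAction u1Rep U)) =
      ∏ y : Site 2 L, u1W β (plaquetteHolonomy U y 0 1) := by
  rw [wilsonWeight_two_u1_eq_prod, ENNReal.ofReal_prod_of_nonneg fun y _ => ENNReal.toReal_nonneg]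
  refine Finset.prod_congr rfl fun y _ => ENNReal.ofReal_toReal ?_
  rw [u1W_apply]; exact ENNReal.ofReal_ne_top

/-- The Wilson weight is measurable, at most one for `β ≥ 0`, and at least `e^{−2βL²}`. [ours] -/
theorem wilsonWeight_two_u1_props (hβ : 0 ≤ β) :
    Measurable (fun U : GaugeConfig 2 L Circle => Real.exp (-β * wilsonAction u1Rep U)) ∧
      (∀ U : GaugeConfig 2 L Circle, |Real.exp (-β * wilsonAction u1Rep U)| ≤ 1) ∧
      ∀ U : GaugeConfig 2 L Circle,
        Real.exp (-(2 * β * (L : ℝ) ^ 2)) ≤ Real.exp (-β * wilsonAction u1Rep U) := by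
  refine ⟨Real.measurable_exp.comp ((measurable_wilsonAction u1Rep continuous_u1Rep).const_mul _),
    fun U => ?_, fun U => ?_⟩
  · rw [abs_of_pos (Real.exp_pos _), wilsonWeight_two_u1_eq_prod]
    refine Finset.prod_le_one (fun y _ => ENNReal.toReal_nonneg) fun y _ => ?_
    exact ENNReal.toReal_le_of_le_ofReal zero_le_one (by simpa using u1W_le_one hβ _)
  · rw [wilsonWeight_two_u1_eq_prod]
    have hcard : (Finset.univ : Finset (Site 2 L)).card = L ^ 2 := by
      rw [Finset.card_univ, Fintype.card_fun, ZMod.card, Fintype.card_fin]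
    have hterm : ∀ y ∈ (Finset.univ : Finset (Site 2 L)),
        Real.exp (-(2 * β)) ≤ (u1W β (plaquetteHolonomy U y 0 1)).toReal := by
      intro y _
      rw [u1W_apply, ENNReal.toReal_ofReal (Real.exp_pos _).le]
      refine Real.exp_le_exp.2 ?_
      have h1 : -1 ≤ ((plaquetteHolonomy U y 0 1 : Circle) : ℂ).re :=
        (abs_le.1 (abs_circle_re_le_one (plaquetteHolonomy U y 0 1))).1
      nlinarith
    calc Real.exp (-(2 * β * (L : ℝ) ^ 2)) = ∏ _y : Site 2 L, Real.exp (-(2 * β)) := by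
          rw [Finset.prod_const, hcard, ← Real.exp_nat_mul]; congr 1; push_cast; ring
      _ ≤ _ := Finset.prod_le_prod (fun y _ => (Real.exp_pos _).le) hterm

/-! ## §3 The one-plaquette law: `∫ 1_A(hol_x U) F(U) dU = ∫_A D dHaar` -/

/-- **THE LAW OF ONE PLAQUETTE HOLONOMY of the 2-d `U(1)` Wilson weight**: for every measurable
`A ⊆ U(1)`, `∫ 1_A(hol_x U) · e^{−β S_W(U)} dHaar^{⊗E}(U) = ∫_A (w_β·(K_w^{L²−2} w_β)).toReal dHaar`
(`β ≥ 0`, `L ≥ 2`; the exact plaquette-marginal formula of `Scaling/PlaquetteMarginals2D` with one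
retained plaquette and the puncture at `x + e₀`). [ours] -/
theorem wilson2D_u1_setIntegral_holonomy_eq (hL : 2 ≤ L) (hβ : 0 ≤ β) (x : Site 2 L) {A : Set Circle}
    (hA : MeasurableSet A) :
    ∫ U, A.indicator (fun _ => (1 : ℝ)) (plaquetteHolonomy U x 0 1) * Real.exp (-β * wilsonAction u1Rep U)
        ∂Measure.pi (fun _ : Edge 2 L => haarProbability Circle) =
      ∫ g in A, (u1W β g * (haarConv (u1W β))^[L ^ 2 - 2] (u1W β) g).toReal
        ∂(haarProbability Circle) := by
  classical
  set w := u1W β with hw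
  have hwm : Measurable w := measurable_u1W β
  obtain ⟨hFm, hFb, -⟩ := wilsonWeight_two_u1_props (L := L) β hβ
  let φ : Circle → ℝ := A.indicator fun _ => 1
  have hφm : Measurable φ := measurable_const.indicator hA
  have hφb : ∀ g, |φ g| ≤ 1 := fun g => by
    simp only [φ, Set.indicator_apply]; split_ifs <;> simp
  have hφnn : ∀ g, 0 ≤ φ g := fun g => by
    simp only [φ, Set.indicator_apply]; split_ifs <;> simp
  have hKle : ∀ g, w g * (haarConv w)^[L ^ 2 - 2] w g ≤ 1 := fun g =>
    mul_le_one' (u1W_le_one hβ g) (iterate_apply_le_one hwm (u1W_le_one hβ) _ g)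
  have hDm : Measurable fun g => (w g * (haarConv w)^[L ^ 2 - 2] w g).toReal :=
    (hwm.mul (measurable_iterate hwm hwm _)).ennreal_toReal
  have hDb : ∀ g, |(w g * (haarConv w)^[L ^ 2 - 2] w g).toReal| ≤ 1 := fun g => by
    rw [abs_of_nonneg ENNReal.toReal_nonneg]
    exact ENNReal.toReal_le_of_le_ofReal zero_le_one (by simpa using hKle g)
  -- right side as `∫ φ · D`
  have hset : ∫ g in A, (w g * (haarConv w)^[L ^ 2 - 2] w g).toReal ∂(haarProbability Circle) =
      ∫ g, φ g * (w g * (haarConv w)^[L ^ 2 - 2] w g).toReal ∂(haarProbability Circle) := by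
    rw [← integral_indicator hA]
    refine integral_congr_ae (ae_of_all _ fun g => ?_)
    simp only [φ, Set.indicator_apply]
    split_ifs <;> simp
  rw [hset]
  -- both sides are integrals of non-negative functions: go through `lintegral`
  have hLnn : ∀ U : GaugeConfig 2 L Circle,
      0 ≤ φ (plaquetteHolonomy U x 0 1) * Real.exp (-β * wilsonAction u1Rep U) := fun U =>
    mul_nonneg (hφnn _) (Real.exp_pos _).le
  have hRnn : ∀ g, 0 ≤ φ g * (w g * (haarConv w)^[L ^ 2 - 2] w g).toReal := fun g =>
    mul_nonneg (hφnn _) ENNReal.toReal_nonneg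
  have hLi : Integrable (fun U : GaugeConfig 2 L Circle =>
      φ (plaquetteHolonomy U x 0 1) * Real.exp (-β * wilsonAction u1Rep U))
      (Measure.pi fun _ : Edge 2 L => haarProbability Circle) :=
    Integrable.mono' (integrable_const (1 * 1))
      (((hφm.comp (measurable_plaquetteHolonomy x 0 1)).mul hFm).aestronglyMeasurable)
      (ae_of_all _ fun U => by
        rw [Real.norm_eq_abs, abs_mul]
        exact mul_le_mul (hφb _) (hFb _) (abs_nonneg _) zero_le_one)
  have hRi : Integrable (fun g => φ g * (w g * (haarConv w)^[L ^ 2 - 2] w g).toReal)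
      (haarProbability Circle) :=
    Integrable.mono' (integrable_const (1 * 1)) ((hφm.mul hDm).aestronglyMeasurable)
      (ae_of_all _ fun g => by
        rw [Real.norm_eq_abs, abs_mul]
        exact mul_le_mul (hφb _) (hDb _) (abs_nonneg _) zero_le_one)
  rw [integral_eq_lintegral_of_nonneg_ae (ae_of_all _ hLnn) hLi.aestronglyMeasurable,
    integral_eq_lintegral_of_nonneg_ae (ae_of_all _ hRnn) hRi.aestronglyMeasurable]
  congr 1
  have hLpt : ∀ U : GaugeConfig 2 L Circle,
      ENNReal.ofReal (φ (plaquetteHolonomy U x 0 1) * Real.exp (-β * wilsonAction u1Rep U)) =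
        (fun gf : Site 2 L → Circle => ENNReal.ofReal (φ (gf x))) (fun y => plaquetteHolonomy U y 0 1) *
          ∏ y, w (plaquetteHolonomy U y 0 1) := by
    intro U
    rw [ENNReal.ofReal_mul (hφnn _), ofReal_wilsonWeight_two_u1_eq_prod]
  simp_rw [hLpt]
  have x0ne : x.shift 0 ≠ x := site_shift_ne hL x 0
  have hcard : ((Finset.univ.erase (x.shift 0)) \ ({x} : Finset (Site 2 L))).card = L ^ 2 - 2 := by
    have h1 : ((Finset.univ.erase (x.shift 0)) \ ({x} : Finset (Site 2 L))).card = L ^ 2 - 1 - 1 := by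
      rw [Finset.sdiff_singleton_eq_erase, Finset.card_erase_of_mem (by simp [Ne.symm x0ne]),
        Finset.card_erase_of_mem (Finset.mem_univ _), Finset.card_univ, Fintype.card_fun, ZMod.card,
        Fintype.card_fin]
    exact h1.trans (Nat.sub_sub _ 1 1)
  rw [lintegral_weight_mul_eq_iterate hL hwm (u1W_symm β) (x.shift 0) {x}
    (by simpa using x0ne) (f := fun gf : Site 2 L → Circle => ENNReal.ofReal (φ (gf x)))
    ((hφm.comp (measurable_pi_apply x)).ennreal_ofReal)
    (fun g g' hgg' => by simp only [hgg' x (Finset.mem_singleton_self x)]), hcard]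
  simp only [Finset.prod_singleton]
  have hev := (measurePreserving_eval (fun _ : Site 2 L => haarProbability Circle) x).lintegral_comp
    (f := fun h : Circle => ENNReal.ofReal (φ h) * w h * (haarConv w)^[L ^ 2 - 2] w h)
    ((hφm.ennreal_ofReal.mul hwm).mul (measurable_iterate hwm hwm _))
  simp only [Function.eval] at hev
  rw [hev]
  refine lintegral_congr fun h => ?_
  rw [ENNReal.ofReal_mul (hφnn _), ENNReal.ofReal_toReal (ne_top_of_le_ne_top ENNReal.one_ne_top
    (hKle _)), mul_assoc]

/-! ## §4 Continuity of the density; it is not a.e. constant -/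

/-- **The convolution powers `K_wᵐ w_β` of the `U(1)` Wilson weight are continuous** (as real
functions; `β ≥ 0`): `(K_w^{m+1} w)(u) = ∫ (K_wᵐ w)(v)·w(u⁻¹v) dv` with a bounded measurable first
factor and a continuous bounded second factor — dominated convergence. [ours] -/
theorem continuous_u1_iterate_toReal (hβ : 0 ≤ β) (m : ℕ) :
    Continuous fun u : Circle => ((haarConv (u1W β))^[m] (u1W β) u).toReal := by
  have hwc : Continuous fun g : Circle => Real.exp (-(β * (1 - ((g : Circle) : ℂ).re))) :=
    Real.continuous_exp.comp ((continuous_const.sub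
      (Complex.continuous_re.comp continuous_subtype_val)).const_smul β |>.neg)
  have hwR : ∀ g : Circle, (u1W β g).toReal = Real.exp (-(β * (1 - ((g : Circle) : ℂ).re))) :=
    fun g => by rw [u1W_apply, ENNReal.toReal_ofReal (Real.exp_pos _).le]
  cases m with
  | zero => simp only [Function.iterate_zero, id_eq, hwR]; exact hwc
  | succ k =>
    set μ := haarProbability Circle
    have hw : Measurable (u1W β) := measurable_u1W β
    set f := (haarConv (u1W β))^[k] (u1W β) with hf
    have hfm : Measurable f := measurable_iterate hw hw k
    have hf1 : ∀ v, f v ≤ 1 := iterate_apply_le_one hw (u1W_le_one hβ) k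
    have hfT : ∀ v, f v ≠ ⊤ := fun v => ne_top_of_le_ne_top ENNReal.one_ne_top (hf1 v)
    -- the real integrand
    let Fr : Circle → Circle → ℝ := fun u v =>
      (f v).toReal * Real.exp (-(β * (1 - (((u⁻¹ * v : Circle)) : ℂ).re)))
    have hFr_nn : ∀ u v, 0 ≤ Fr u v := fun u v => mul_nonneg ENNReal.toReal_nonneg (Real.exp_pos _).le
    have heq : ∀ u, ((haarConv (u1W β))^[k + 1] (u1W β) u).toReal = ∫ v, Fr u v ∂μ := by
      intro u
      rw [Function.iterate_succ_apply', haarConv_eq_lintegral_mul_inv]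
      have hpt : ∀ v, f v * u1W β (u⁻¹ * v) = ENNReal.ofReal (Fr u v) := by
        intro v
        simp only [Fr]
        rw [ENNReal.ofReal_mul ENNReal.toReal_nonneg, ENNReal.ofReal_toReal (hfT v), u1W_apply]
      have hFi : Integrable (Fr u) μ := by
        refine Integrable.mono' (integrable_const 1) ?_ (ae_of_all _ fun v => ?_)
        · exact ((hfm.ennreal_toReal).mul (hwc.measurable.comp (measurable_const_mul u⁻¹))
            ).aestronglyMeasurable
        · rw [Real.norm_eq_abs, abs_of_nonneg (hFr_nn u v)]
          have h1 : (f v).toReal ≤ 1 :=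
            ENNReal.toReal_le_of_le_ofReal zero_le_one (by simpa using hf1 v)
          have h2 : Real.exp (-(β * (1 - (((u⁻¹ * v : Circle)) : ℂ).re))) ≤ 1 := by
            rw [← hwR]; exact ENNReal.toReal_le_of_le_ofReal zero_le_one (by simpa using u1W_le_one hβ _)
          exact mul_le_one₀ h1 (Real.exp_pos _).le h2
      rw [lintegral_congr hpt, ← ofReal_integral_eq_lintegral_ofReal hFi (ae_of_all _ (hFr_nn u)),
        ENNReal.toReal_ofReal (integral_nonneg (hFr_nn u))]
    simp_rw [heq]
    refine continuous_of_dominated (F := Fr) (bound := fun _ => 1) (fun u => ?_) (fun u => ?_)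
      (integrable_const 1) (ae_of_all _ fun v => ?_)
    · exact ((hfm.ennreal_toReal).mul (hwc.measurable.comp (measurable_const_mul u⁻¹))
        ).aestronglyMeasurable
    · refine ae_of_all _ fun v => ?_
      rw [Real.norm_eq_abs, abs_of_nonneg (hFr_nn u v)]
      have h1 : (f v).toReal ≤ 1 := ENNReal.toReal_le_of_le_ofReal zero_le_one (by simpa using hf1 v)
      have h2 : Real.exp (-(β * (1 - (((u⁻¹ * v : Circle)) : ℂ).re))) ≤ 1 := by
        rw [← hwR]; exact ENNReal.toReal_le_of_le_ofReal zero_le_one (by simpa using u1W_le_one hβ _)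
      exact mul_le_one₀ h1 (Real.exp_pos _).le h2
    · exact continuous_const.mul (hwc.comp ((continuous_inv.mul continuous_const)))

/-- **The one-plaquette density is NOT a.e. constant** (`β > 0`, any `m`): `D = (w·K_wᵐ w).toReal`
is continuous, `D(−1) < D(1)`, and Haar measure charges open sets. [ours] -/
theorem wilson2D_u1_density_not_ae_const (hβ : 0 < β) (m : ℕ) (κ : ℝ) :
    ¬ ((fun g : Circle => (u1W β g * (haarConv (u1W β))^[m] (u1W β) g).toReal) =ᵐ[haarProbability Circle]
      fun _ => κ) := by
  intro h
  have hcont : Continuous fun g : Circle => (u1W β g * (haarConv (u1W β))^[m] (u1W β) g).toReal := by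
    have h1 : ∀ g : Circle, (u1W β g * (haarConv (u1W β))^[m] (u1W β) g).toReal =
        (u1W β g).toReal * ((haarConv (u1W β))^[m] (u1W β) g).toReal := fun g => ENNReal.toReal_mul
    simp_rw [h1]
    exact (continuous_u1_iterate_toReal β hβ.le 0).mul (continuous_u1_iterate_toReal β hβ.le m)
  have heq := (Continuous.ae_eq_iff_eq (haarProbability Circle) hcont continuous_const).1 h
  have hlt := u1_plaquetteDensity_lt hβ m (Circle.neg_ne_self 1)
  have hne1 : u1W β 1 * (haarConv (u1W β))^[m] (u1W β) 1 ≠ ⊤ :=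
    ne_top_of_le_ne_top ENNReal.one_ne_top (mul_le_one' (u1W_le_one hβ.le 1)
      (iterate_apply_le_one (measurable_u1W β) (u1W_le_one hβ.le) m 1))
  have h1 := congrFun heq (-1)
  have h2 := congrFun heq 1
  have := ENNReal.toReal_strict_mono hne1 hlt
  rw [h1, h2] at this
  exact lt_irrefl _ this

end TwoDimU1

end Summit.Ventures.LatticeQCDFlow.Theory2.Autoregressive

end
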